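import Summits.HodgeConjecture.CorCM.MultiFieldWeilUnitSeparation
import HarnessLib

/-!
# MULTI-FIELD WEIL ENGINE — THE DEFECT LAW WITH UNITS OF ANY SIZE: tuple sets whose slots are grouped into units reading one frame (several CM types of ONE field),
# `2`-transitive on every unit with at least two slots, the centred indicators of the position sets of each unit linearly independent; the slot menu on the single slots
# (census level)

Cell `pub-hodgecm2` (COR-CM), seat b30 gen 39 (2026-08-25); count-neutral own lane MULTI-FIELD WEIL ENGINE (stem `MultiFieldWeil*`), census level, the sequel of
`CorCM/MultiFieldWeilUnitSeparation.lean` (U1: the cell identity and separation from linear independence) replacing the twin pairs of gen 38's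
`CorCM/MultiFieldWeilTwinUnitsKind.lean` (T1c: units of size `≤ 2` with SINGLETON position sets) by UNITS OF ANY SIZE WITH ARBITRARY POSITION SETS.  Theorems only; no
definition, no named fact, no `sorry`, no `decide`.  HONEST FRAMING: pure finite combinatorics; `HC_CM` is NOT touched.

**`exists_hasDefectsG_of_unitsStabiliserTransitive`.**  `R ⊆ ∏_m Sym(n_m)` non-empty, closed under products and inverses, transitive on every slot; the slots are
grouped into UNITS, the fibres of a map `U : Fin r → Fin r`; inside a unit all sizes agree (`hn`) and every tuple of `R` is DIAGONAL (`hdiag`); on every unit with at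
least two slots the components are `2`-TRANSITIVE (`h2t`) and the centred indicators `n·𝟙_{P_{m'}} − |P_{m'}|·𝟙` of the position sets of its slots, read in one
`Fin (n m)`, are LINEARLY INDEPENDENT over `ℚ` (`hli`); `R` is STABILISER-TRANSITIVE ACROSS UNITS (`hstab`: a tuple trivial on the whole unit of `m₀` moves `m`
arbitrarily, `U m ≠ U m₀`); every slot ALONE in its unit obeys Z1's menu (`hkind`: prime size with a proper non-empty position set ∕ one-member position set ∕ homogeneous
image).  Then every configuration balanced under `R` obeys the defect law.  PROOF = T1c's: transfer the signed equations to the unit-wise product `R⁺`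
(`signed_transfer_units`); a single slot is moved alone inside `R⁺` (Z1 `sum_preG_eq_of_signed_update`, `sep_of_kind`); a larger unit is moved alone inside `R⁺` by the
hybrids `(π|_unit, 1)` — a set of tuples closed under products, `2`-transitive on the unit, on which the unit's signed sum is constant — and U1's
`const_of_signed_unit_of_linearIndependent`, read in the size of one slot of the unit through the casts, makes its defects constant; `exists_defects_of_const`.
§2 adds the small lemmas the realised reading needs: DISTINCT SINGLETONS missing a letter have independent centred indicators (`linearIndependent_cells_of_singletons` —
three `(1,3)`-classes over one octic field), the complementary reading (`eq_decide_iff_not_eq_decide`), casts to the same size (`image_cast_self`).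
USE (sequel, realised reading): several simple CM abelian varieties over ONE field of the multi-field menu — up to three isogeny classes of simple fourfolds over one
`𝔄₄`/`𝔖₄`-octic field, `(2,3)`-twins over one decic field with `2`-transitive quintic part, sextic twins — inside the menu with `Hom = ∅` between different fields.
[cite: MoonenZarhin1995Duke, Thm. 2.4] [cite: Pohlmann1968, Thm 1] [cite: GaoUllmo2025, Thm 3.1] [cite: DixonMortimer1996, §1.4 Ex. 1.4.1–1.4.2; §1.6, Thm. 1.6A; §2.1]
[cite: Lang2002, XIII §4]

## References
* [MoonenZarhin1995Duke] B. Moonen, Yu. Zarhin, Duke Math. J. 77 (1995), Thm. 2.4.  [Pohlmann1968] H. Pohlmann, Ann. of Math. 88 (1968), Thm 1.  [GaoUllmo2025] Z. Gao, E. Ullmo,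
  J. Inst. Math. Jussieu 25 (2025), Thm 3.1.  [DixonMortimer1996] J. D. Dixon, B. Mortimer, *Permutation Groups*, GTM 163, §1.4, §1.6 (Thm. 1.6A), §2.1.  [Lang2002] S. Lang,
  *Algebra*, GTM 211, XIII §4.
-/

noncomputable section

namespace Summit.HodgeConjecture.CorCM.MultiFieldWeil

open Finset
open Summit.HodgeConjecture.CorCM.Census.MultiFieldWeil

open scoped Classical

/-! ## §1 The defect law with units -/

section Model

variable {r : ℕ} {n : Fin r → ℕ} {R : Finset (PermsG n)} {P : ∀ m : Fin r, Finset (Fin (n m))}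

/-- **THE DEFECT LAW WITH UNITS OF ANY SIZE AND THE SLOT MENU ON THE SINGLE SLOTS.**  See the module docstring.  (T1c `exists_hasDefectsG_of_twinsStabiliserTransitive_kind`
is the case of the units `{m, tw m}` of an involution with singleton position sets.) [cite: MoonenZarhin1995Duke, Thm. 2.4]
[cite: DixonMortimer1996, §1.4 Ex. 1.4.1–1.4.2; §1.6, Thm. 1.6A; §2.1] [cite: GaoUllmo2025, Thm 3.1] [cite: Lang2002, XIII §4] -/
theorem exists_hasDefectsG_of_unitsStabiliserTransitive (hmul : ∀ π ∈ R, ∀ π' ∈ R, π * π' ∈ R) (hinv : ∀ π ∈ R, π⁻¹ ∈ R) (hne : R.Nonempty)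
    (htrans : ∀ (m : Fin r) (a a' : Fin (n m)), ∃ π ∈ R, π m a = a')
    (U : Fin r → Fin r) (hn : ∀ m m' : Fin r, U m' = U m → n m' = n m)
    (hdiag : ∀ π ∈ R, ∀ (m m' : Fin r) (h : U m' = U m) (a : Fin (n m')), Fin.cast (hn m m' h) (π m' a) = π m (Fin.cast (hn m m' h) a))
    (h2t : ∀ m, (∃ m', m' ≠ m ∧ U m' = U m) → ∀ a a' b b' : Fin (n m), a ≠ a' → b ≠ b' → ∃ π ∈ R, π m a = b ∧ π m a' = b')
    (hstab : ∀ (m₀ m : Fin r), U m₀ ≠ U m → ∀ a a' : Fin (n m), ∃ ν ∈ R, (∀ m', U m' = U m₀ → ν m' = 1) ∧ ν m a = a')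
    (hkind : ∀ m, (∀ m', U m' = U m → m' = m) → ((n m).Prime ∧ (P m).Nonempty ∧ (P m).card < n m) ∨ (P m).card = 1 ∨
      ((0 < (P m).card ∧ (P m).card < n m) ∧ ∀ Q : Finset (Fin (n m)), Q.card = (P m).card → ∃ π ∈ R, preG (π m) (P m) = Q))
    (hli : ∀ m, (∃ m', m' ≠ m ∧ U m' = U m) → LinearIndependent ℚ fun m' : {m' : Fin r // U m' = U m} => fun q : Fin (n m) =>
      ((n m : ℚ) * (if q ∈ (P m'.1).image (Fin.cast (hn m m'.1 m'.2)) then 1 else 0) - (P m'.1).card))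
    (c : Fin r → ℕ) (hc : ∀ m, ((c m : ℕ) : ℤ) = (n m : ℤ) - 2 * (P m).card)
    {α : Type} (v : α → PtG n) (T : Finset α) (hT : ModelBalancedG P R v T) : ∃ t : Fin r → ℤ, HasDefectsG c v T t := by
  have h1R : (1 : PermsG n) ∈ R := one_mem_of_closed hmul hinv hne
  -- the unit-wise product `R'`
  set R' : Finset (PermsG n) := Finset.univ.filter fun π' => ∀ m₀, ∃ π ∈ R, ∀ m, U m = U m₀ → π m = π' m with hR'
  have hmemR' : ∀ π' : PermsG n, π' ∈ R' ↔ ∀ m₀, ∃ π ∈ R, ∀ m, U m = U m₀ → π m = π' m := fun π' => by simp [hR']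
  have hRR' : R ⊆ R' := fun π hπ => (hmemR' π).2 fun m₀ => ⟨π, hπ, fun _ _ => rfl⟩
  have hmul' : ∀ π ∈ R', ∀ π' ∈ R', π * π' ∈ R' := by
    intro π₁ h₁ π₂ h₂
    rw [hmemR'] at h₁ h₂ ⊢
    intro m₀
    obtain ⟨ρ₁, hρ₁, e₁⟩ := h₁ m₀
    obtain ⟨ρ₂, hρ₂, e₂⟩ := h₂ m₀
    exact ⟨ρ₁ * ρ₂, hmul _ hρ₁ _ hρ₂, fun m hm => by rw [Pi.mul_apply, Pi.mul_apply, e₁ m hm, e₂ m hm]⟩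
  have hinv' : ∀ π ∈ R', π⁻¹ ∈ R' := by
    intro π₁ h₁
    rw [hmemR'] at h₁ ⊢
    intro m₀
    obtain ⟨ρ, hρ, e⟩ := h₁ m₀
    exact ⟨ρ⁻¹, hinv _ hρ, fun m hm => by rw [Pi.inv_apply, Pi.inv_apply, e m hm]⟩
  have hne' : R'.Nonempty := hne.mono hRR'
  have h1R' : (1 : PermsG n) ∈ R' := hRR' h1R
  -- hybrids: a tuple of `R` on the unit of `m`, the identity elsewhere, lies in `R'`
  have hhyb : ∀ (m : Fin r) (π : PermsG n), π ∈ R → (fun m' => if U m' = U m then π m' else 1) ∈ R' := by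
    intro m π hπ
    rw [hmemR']
    intro m₀
    by_cases hm₀ : U m₀ = U m
    · refine ⟨π, hπ, fun m' hm' => ?_⟩
      simp only [hm'.trans hm₀, if_true]
    · refine ⟨1, h1R, fun m' hm' => ?_⟩
      have : U m' ≠ U m := fun h => hm₀ (hm'.symm.trans h)
      simp only [this, if_false, Pi.one_apply]
  -- diagonality inside `R'`
  have hdiag' : ∀ π ∈ R', ∀ (m m' : Fin r) (h : U m' = U m) (a : Fin (n m')), Fin.cast (hn m m' h) (π m' a) = π m (Fin.cast (hn m m' h) a) := by
    intro π hπ m m' h a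
    obtain ⟨ρ, hρ, hρe⟩ := (hmemR' π).1 hπ m
    rw [← hρe m rfl, ← hρe m' h]
    exact hdiag ρ hρ m m' h a
  -- the defects and the signed equations at `R`, transferred to `R'`
  set d : ∀ m : Fin r, Fin (n m) → ℤ := fun m a => ((cnt v T (Sum.inr ⟨m, (a, true)⟩)) : ℤ) - cnt v T (Sum.inr ⟨m, (a, false)⟩) with hd
  have hsig : ∀ π ∈ R', (((cnt v T (Sum.inl true)) : ℤ) - cnt v T (Sum.inl false)) +
      ∑ m : Fin r, ∑ a : Fin (n m), (if π m a ∈ P m then d m a else -d m a) = 0 := fun π' hπ' =>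
    signed_transfer_units (d := d) U hmul hne htrans hstab (fun π hπ => signed_of_modelBalancedG R v hT hπ) π' ((hmemR' π').1 hπ')
  -- every SINGLE slot is moved ALONE inside `R'`: its defect is constant by slot-wise separation (Z1)
  have hupd : ∀ m₀, (∀ m', U m' = U m₀ → m' = m₀) → ∀ π₁ ∈ R, Function.update (1 : PermsG n) m₀ (π₁ m₀) ∈ R' := by
    intro m₀ hsingle π₁ hπ₁
    refine (hmemR' _).2 fun m' => ?_
    by_cases hm' : U m' = U m₀
    · refine ⟨π₁, hπ₁, fun m hmm => ?_⟩
      have hmm' : m = m₀ := hsingle m (hmm.trans hm')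
      subst hmm'
      rw [Function.update_self]
    · refine ⟨1, h1R, fun m hmm => ?_⟩
      have hmm' : m ≠ m₀ := fun h => hm' (by rw [← h, hmm])
      rw [Function.update_of_ne hmm', Pi.one_apply]
  have hconst : ∀ m₀, (∀ m', U m' = U m₀ → m' = m₀) → ∀ a b : Fin (n m₀), d m₀ a = d m₀ b := fun m₀ hsingle =>
    sep_of_kind hmul hinv hne (htrans m₀) (hkind m₀ hsingle) (d m₀) fun π hπ => sum_preG_eq_of_signed_update (d := d) h1R' (hupd m₀ hsingle π hπ) hsig
  -- every LARGER unit is moved ALONE inside `R'` by the hybrids `(π|_unit, 1)`: U1's unit separation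
  have hunits : ∀ m, (∃ m', m' ≠ m ∧ U m' = U m) → ∀ a b : Fin (n m), d m a = d m b := by
    intro m hm
    -- the tuples of `R'` trivial off the unit of `m`
    let D : Finset (PermsG n) := R'.filter fun π => ∀ m', U m' ≠ U m → π m' = 1
    have hD : ∀ π, π ∈ D ↔ π ∈ R' ∧ ∀ m', U m' ≠ U m → π m' = 1 := fun π => Finset.mem_filter
    have hhybD : ∀ π ∈ R, (fun m' => if U m' = U m then π m' else 1) ∈ D := fun π hπ =>
      (hD _).2 ⟨hhyb m π hπ, fun m' hm' => by simp only [hm', if_false]⟩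
    have hmulD : ∀ π ∈ D, ∀ π' ∈ D, π * π' ∈ D := by
      intro π hπ π' hπ'
      obtain ⟨h₁, h₁'⟩ := (hD π).1 hπ
      obtain ⟨h₂, h₂'⟩ := (hD π').1 hπ'
      exact (hD _).2 ⟨hmul' _ h₁ _ h₂, fun m' hm' => by rw [Pi.mul_apply, h₁' m' hm', h₂' m' hm', mul_one]⟩
    -- its image at the slot `m`: closed under products, `2`-transitive
    let Hm : Finset (Equiv.Perm (Fin (n m))) := D.image fun π => π m
    have hHm : ∀ σ, σ ∈ Hm ↔ ∃ π ∈ D, π m = σ := fun σ => Finset.mem_image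
    have hmulH : ∀ σ ∈ Hm, ∀ σ' ∈ Hm, σ * σ' ∈ Hm := by
      intro σ hσ σ' hσ'
      obtain ⟨π, hπ, rfl⟩ := (hHm σ).1 hσ
      obtain ⟨π', hπ', rfl⟩ := (hHm σ').1 hσ'
      exact (hHm _).2 ⟨π * π', hmulD π hπ π' hπ', rfl⟩
    have h2tH : ∀ a a' b b' : Fin (n m), a ≠ a' → b ≠ b' → ∃ σ ∈ Hm, σ a = b ∧ σ a' = b' := by
      intro a a' b b' haa hbb
      obtain ⟨π, hπ, hb, hb'⟩ := h2t m hm a a' b b' haa hbb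
      refine ⟨π m, (hHm _).2 ⟨_, hhybD π hπ, by show (if U m = U m then π m else 1) = π m; rw [if_pos rfl]⟩, hb, hb'⟩
    -- the unit's signed sum is constant on `D`
    set w : ℤ := -((((cnt v T (Sum.inl true)) : ℤ) - cnt v T (Sum.inl false)) +
      ∑ m' ∈ Finset.univ.filter (fun m' => ¬ U m' = U m), ∑ a : Fin (n m'), (if (1 : PermsG n) m' a ∈ P m' then d m' a else -d m' a)) with hw
    have heqD : ∀ π ∈ D, (∑ m' ∈ Finset.univ.filter (fun m' => U m' = U m), ∑ a : Fin (n m'), (if π m' a ∈ P m' then d m' a else -d m' a)) = w := by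
      intro π hπ
      obtain ⟨hπR', hπfix⟩ := (hD π).1 hπ
      have hs := hsig π hπR'
      rw [← Finset.sum_filter_add_sum_filter_not Finset.univ (fun m' => U m' = U m)] at hs
      have hrest : (∑ m' ∈ Finset.univ.filter (fun m' => ¬ U m' = U m), ∑ a : Fin (n m'), (if π m' a ∈ P m' then d m' a else -d m' a)) =
          ∑ m' ∈ Finset.univ.filter (fun m' => ¬ U m' = U m), ∑ a : Fin (n m'), (if (1 : PermsG n) m' a ∈ P m' then d m' a else -d m' a) :=
        Finset.sum_congr rfl fun m' hm' => by rw [hπfix m' (Finset.mem_filter.1 hm').2, Pi.one_apply]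
      rw [hrest] at hs
      simp only [hw]
      linarith
    -- read the unit in the size `n m` through the casts
    let ι : Type := {m' : Fin r // U m' = U m}
    let Q : ι → Finset (Fin (n m)) := fun i => (P i.1).image (Fin.cast (hn m i.1 i.2))
    let u : ι → Fin (n m) → ℤ := fun i x => d i.1 (Fin.cast (hn m i.1 i.2).symm x)
    have hcc : ∀ (i : ι) (a : Fin (n i.1)), Fin.cast (hn m i.1 i.2).symm (Fin.cast (hn m i.1 i.2) a) = a := fun i a => Fin.ext rfl
    have hslot : ∀ π ∈ D, ∀ i : ι, (∑ x : Fin (n m), (if π m x ∈ Q i then u i x else -u i x)) =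
        ∑ a : Fin (n i.1), (if π i.1 a ∈ P i.1 then d i.1 a else -d i.1 a) := by
      intro π hπ i
      symm
      refine Fintype.sum_equiv (finCongr (hn m i.1 i.2)) _ _ fun a => ?_
      have hπa : π m (Fin.cast (hn m i.1 i.2) a) = Fin.cast (hn m i.1 i.2) (π i.1 a) := (hdiag' π ((hD π).1 hπ).1 m i.1 i.2 a).symm
      simp only [finCongr_apply, Q, u, hπa, (Fin.cast_injective _).mem_finset_image, hcc]
    have heqH : ∀ σ ∈ Hm, (∑ i : ι, ∑ x : Fin (n m), (if σ x ∈ Q i then u i x else -u i x)) = w := by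
      intro σ hσ
      obtain ⟨π, hπ, rfl⟩ := (hHm σ).1 hσ
      rw [Finset.sum_congr rfl fun i _ => hslot π hπ i, ← heqD π hπ]
      exact (Finset.sum_subtype (Finset.univ.filter fun m' => U m' = U m) (fun m' => by simp only [Finset.mem_filter, Finset.mem_univ, true_and])
        (fun m' => ∑ a : Fin (n m'), (if π m' a ∈ P m' then d m' a else -d m' a))).symm
    -- the independence hypothesis in U1's form (the image has the same cardinality)
    have hli' : LinearIndependent ℚ fun i : ι => fun q : Fin (n m) => ((n m : ℚ) * (if q ∈ Q i then 1 else 0) - (Q i).card) := by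
      have hfun : (fun i : ι => fun q : Fin (n m) => ((n m : ℚ) * (if q ∈ Q i then 1 else 0) - (Q i).card)) =
          fun i : ι => fun q : Fin (n m) => ((n m : ℚ) * (if q ∈ (P i.1).image (Fin.cast (hn m i.1 i.2)) then 1 else 0) - (P i.1).card) := by
        funext i q
        simp only [Q, Finset.card_image_of_injective _ (Fin.cast_injective _)]
      rw [hfun]
      exact hli m hm
    have hsep := const_of_signed_unit_of_linearIndependent hmulH h2tH Q u heqH hli' ⟨m, rfl⟩
    intro a b
    have ha : d m a = u ⟨m, rfl⟩ (Fin.cast (hn m m rfl) a) := by simp only [u, hcc ⟨m, rfl⟩]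
    have hb : d m b = u ⟨m, rfl⟩ (Fin.cast (hn m m rfl) b) := by simp only [u, hcc ⟨m, rfl⟩]
    rw [ha, hb]
    exact hsep _ _
  -- all defects are constant
  have hall : ∀ (m : Fin r) (a b : Fin (n m)), d m a = d m b := by
    intro m
    by_cases hm : ∃ m', m' ≠ m ∧ U m' = U m
    · exact hunits m hm
    · push Not at hm
      exact hconst m fun m' hm' => by by_contra h; exact hm m' h hm'
  obtain ⟨t, hdt, he⟩ := exists_defects_of_const (P := P) hne' hall hsig
  refine ⟨t, fun m a => hdt m a, ?_⟩
  rw [he]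
  exact Finset.sum_congr rfl fun m _ => by rw [hc m]

end Model

/-! ## §2 Small lemmas for the realised reading: distinct singletons; complementary readings; casts -/

section Singletons

/-- **DISTINCT SINGLETONS MISSING A LETTER HAVE LINEARLY INDEPENDENT CENTRED INDICATORS** (`k·𝟙_{q_i} − 𝟙`, `i ∈ ι`, `q` injective, some letter outside the range: evaluate a
dependency at that letter, then at each `q_i`). [cite: Lang2002, XIII §4] -/
theorem linearIndependent_cells_of_singletons {k : ℕ} {ι : Type} [Fintype ι] (Q : ι → Finset (Fin k)) (c : ι → ℕ) (q : ι → Fin k)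
    (hQ : ∀ i, Q i = {q i}) (hc : ∀ i, c i = 1) (hq : Function.Injective q) (hx : ∃ x, ∀ i, q i ≠ x) :
    LinearIndependent ℚ fun i : ι => fun y : Fin k => ((k : ℚ) * (if y ∈ Q i then 1 else 0) - (c i : ℚ)) := by
  rw [Fintype.linearIndependent_iff]
  intro g hg
  obtain ⟨x, hx⟩ := hx
  have hk : (k : ℚ) ≠ 0 := by exact_mod_cast (show k ≠ 0 by have := x.pos; omega)
  have hE : ∀ y : Fin k, (k : ℚ) * (∑ i, if y ∈ Q i then g i else 0) - ∑ i, g i = 0 := by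
    intro y
    have h := congrFun hg y
    rw [Finset.sum_apply, Pi.zero_apply] at h
    calc (k : ℚ) * (∑ i, if y ∈ Q i then g i else 0) - ∑ i, g i = ∑ i, (g i • fun y => ((k : ℚ) * (if y ∈ Q i then 1 else 0) - (c i : ℚ))) y := by
          rw [Finset.mul_sum, ← Finset.sum_sub_distrib]
          refine Finset.sum_congr rfl fun i _ => ?_
          rw [Pi.smul_apply, smul_eq_mul, hc i, Nat.cast_one]
          split_ifs <;> ring
      _ = 0 := h
  have hG : (∑ i, g i) = 0 := by
    have h := hE x
    rw [Finset.sum_eq_zero fun i _ => if_neg (by rw [hQ i, Finset.mem_singleton]; exact (hx i).symm), mul_zero, zero_sub, neg_eq_zero] at h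
    exact h
  intro i
  have h := hE (q i)
  rw [hG, sub_zero, Finset.sum_eq_single_of_mem i (Finset.mem_univ i) fun j _ hji => if_neg (by rw [hQ j, Finset.mem_singleton]; exact fun h' => hji (hq h').symm),
    if_pos (by rw [hQ i]; exact Finset.mem_singleton_self _)] at h
  exact (mul_eq_zero.1 h).resolve_left hk

/-- Reading a complementary position set flips the membership test. [folklore] -/
theorem eq_decide_iff_not_eq_decide {b : Bool} {p q : Prop} [Decidable p] [Decidable q] (h : q ↔ ¬ p) : (b = decide q) ↔ ¬ (b = decide p) := by
  cases b <;> by_cases hp : p <;> simp [hp, h]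

/-- The image of a set of letters under a cast to the same size is the set itself. [folklore] -/
theorem image_cast_self {n : ℕ} (h : n = n) (Q : Finset (Fin n)) : Q.image (Fin.cast h) = Q := by
  have : Fin.cast h = id := funext fun a => Fin.ext rfl
  rw [this, Finset.image_id]

end Singletons

end Summit.HodgeConjecture.CorCM.MultiFieldWeil

end
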